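import Summits.CriticalPhenomena.PercolationContinuityZ3.Theses.PercLowPointHalfSpace
import Summits.CriticalPhenomena.PercolationContinuityZ3.Theorems.QuantitativeBGN.Negative.ArmLowerBound
import Literature.Probability.Percolation.ProdBernoulliRusso
import Literature.Probability.Percolation.BondPercolationSymmetry

/-!
# Line `microscopic-floor-doubling-gain` for the crux `QuantitativeBGN` (stmt-CriticalPhenomena-0913)

Skeleton (crux-plan, round 1) of the idea card
`Cruxes/QuantitativeBGN/Ideas/microscopic-floor-doubling-gain.md` (ideator 2; triage r1: 3 × pass).

THE LINE. Index the boundary one-arm event of the crux by the DEPTH `h` of the floor below the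
starting point: `γ_r(h) := P_{p_c}(the H-cluster of h·e₀ reaches sup-distance ≥ r from h·e₀)`
(`gammaR r h`; `γ_r(0)` is literally the probability in `QuantitativeBGN`, `gammaR_zero_eq`).
`h ↦ γ_r(h)` is non-decreasing for free (vertical shift + `H₁ ⊆ H`, STUB 1). The lever is the
UNIFORM MICROSCOPIC DOUBLING GAIN `(G)`: `∃ κ δ h₀, ∀ r, ∀ h ∈ [h₀, r^δ/2] : γ_r(2h) ≥ (1+κ) γ_r(h)`
(`FloorGain`); iterating it over the `⌊log₂(r^δ/h₀)⌋` dyadic depths gives the crux with exponent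
`a = δ·log₂(1+κ)` — PROVED here (`quantitativeBGN_of_floorGain`, real analysis + `γ ≤ 1`).
`(G)` itself is cut along its exact FLOOR-PIVOTALITY form (card §(2)(ii), the triage's "concrete
entry"): put the floor edges (both ends on `{x₀ = 0}`) at an independent density `s ∈ [0, p_c]`, all
other edges at `p_c` (`μfloor s = prodBernoulli (floorParams s)`), and let `f_j(s) := P_s(arm from
height j)` (`armProbFloor`). Then
* STUB 2 (`noFloor`): `f_{j+1}(0) ≥ γ_r(j)` — with the floor deleted, `H` seen from height `j+1`
  contains a shifted copy of `H` seen from height `j` (shift + inclusion + `prodBernoulli` marginal);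
* STUB 3 (`floorRusso`): `f_j(p_c) = γ_r(j) ≥ f_j(0) · exp ∫₀^{p_c} Σ_e P_s(e pivotal)/f_j(s) ds`,
  the integrated one-sided Russo formula in the floor parameter (multi-parameter Russo
  `hasDerivAt_prodBernoulli_real` is PROVED in tree; the arm event is a finite-dimensional increasing
  cylinder, so this is `(log f_j)' = f_j'/f_j ≥ (partial pivotal sum)/f_j`, exact up to under-counting);
* STUB 4 (`pivotalFloorDensity`, LOAD-BEARING): on every dyadic block of heights `j ∈ (h, 2h]`,
  `h₀ ≤ h ≤ r^δ/2`, the `s`-integrated conditional pivotal-floor-edge count is bounded below: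
  `Σ_{j ∈ (h,2h]} ∫₀^{p_c} Σ_e P_s(e pivotal for arm_j)/P_s(arm_j) ds ≥ κ'` — "an arm started at height
  `j` makes an essential passage through a floor edge with `s`-averaged probability `≳ 1/j`".
  (By exactness of Russo this is EQUIVALENT to `(G)` on the window `2h < r`, with `1+κ = e^{κ'}`.)
Composition (kernel-checked, no `sorry`): STUB 2+3+4 ⟹ `(G)` (`floorGain_of_russo`, telescoping
product) and STUB 1 + `(G)` ⟹ the crux (`quantitativeBGN_of_floorGain`), assembled in
`QuantitativeBGN_of`, which concludes
`Summit.CriticalPhenomena.PercolationContinuityZ3.Theses.PercLowPointHalfSpace.QuantitativeBGN` BY NAME.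

DISPROOF USED (`Cruxes/QuantitativeBGN/Disproof.lean`, cdisprove v3; Negative lane landed as
`Theorems/QuantitativeBGN/Negative/{ArmLowerBound,LoadBearing}.lean`; the first is imported here):
`quantitativeBGNAt_false_of_criticalProb_lt` (a proof must use `p = p_c`) — honoured at STUB 4, the
only statement of the line that is false above `p_c` (there `γ_r(1) ≥ θ_H(p) > 0` forbids any uniform
gain); `armH_lower_bound` / `not_quantitativeBGNWith_of_two_lt` (window `0 < a ≤ 2`) — respected: the
output exponent is `δ log₂(1+κ)` and `gammaR_pos` below records `γ_r(h) ≥ γ_r(0) ≥ 1/(588 r²) > 0`, so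
every ratio of the line compares positive quantities (no junk); `quantitativeBGN_false_without_rPos` —
the guard `1 ≤ r` is kept (and `1 ≤ h₀`); `not_expDecay_at_criticalProb` — no exponential rate claimed.
No stub is an instance of a landed Negative lemma (they concern `a > 2`, `p ≠ p_c`, `r = 0`).
-/

noncomputable section

namespace Summit.CriticalPhenomena.PercolationContinuityZ3.Cruxes.QuantitativeBGN.MicroscopicFloorDoublingGain

open MeasureTheory Literature.Probability.Percolation Literature.Probability.LatticeModels
open Summit.CriticalPhenomena.PercolationContinuityZ3.Theses.PercLowPointHalfSpace (QuantitativeBGN)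
open scoped Classical

/-! ## Objects of the line -/

/-- The critical bond percolation measure on `ℤ³`. -/
abbrev μc : Measure (BondConfig (Site 3)) := bondPercolation (zdGraph 3) (criticalProbI 3)

/-- The half-space `H = {x₀ ≥ 0}`. -/
abbrev Hsp : Set (Site 3) := {x | 0 ≤ x 0}

/-- `armFrom r h`: the `H`-cluster of the point `h·e₀` (height `h` above the floor) reaches
sup-distance `≥ r` from its starting point, READ ON THE LATTICE PART `ω ∩ E(ℤ³)` of the
configuration (non-edges of `ℤ³` are a.s. closed under every measure of the line, so this changes no
probability — `gammaR_zero_eq` — but it makes the event literally increasing and literally determined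
by the finitely many lattice edges within sup-distance `r` of the start, which is what the
multi-parameter Russo formula `hasDerivAt_prodBernoulli_real` consumes). For `h = 0` its
probability is the probability bounded in the crux. -/
def armFrom (r h : ℕ) : Set (BondConfig (Site 3)) :=
  {ω | ∃ y : Site 3, (∃ i : Fin 3, (r : ℤ) ≤ |y i - (Pi.single 0 (h : ℤ) : Site 3) i|) ∧
    ω ∩ (zdGraph 3).edgeSet ∈ openConnIn Hsp (Pi.single 0 (h : ℤ)) y}

/-- `γ_r(h) := P_{p_c}(armFrom r h)`, the depth-indexed boundary one-arm probability. -/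
def gammaR (r h : ℕ) : ℝ := μc.real (armFrom r h)

/-- The FLOOR edges: lattice edges with both endpoints on the plane `{x₀ = 0}`. -/
def floorEdges : Set (Sym2 (Site 3)) :=
  {e | e ∈ (zdGraph 3).edgeSet ∧ ∀ x ∈ e, x 0 = 0}

/-- Edge densities of the interpolating family: `s` on the floor edges, `p_c` on all other lattice
edges, `0` off the lattice. At `s = p_c` this is critical bond percolation on `ℤ³`. -/
def floorParams (s : unitInterval) : Sym2 (Site 3) → unitInterval :=
  fun e => if e ∈ floorEdges then s else if e ∈ (zdGraph 3).edgeSet then criticalProbI 3 else 0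

/-- The interpolating product measure `P_s` (floor edges at density `s`, the rest at `p_c`). -/
def μfloor (s : unitInterval) : Measure (BondConfig (Site 3)) := prodBernoulli (floorParams s)

/-- `f_j(s) := P_s(armFrom r j)`. -/
def armProbFloor (r j : ℕ) (s : unitInterval) : ℝ := (μfloor s).real (armFrom r j)

/-- The floor edges with both endpoints in the box `Λ_R` (a finite set; for `R ≥ r` it contains
every floor edge that can be pivotal for `armFrom r j`). -/
def floorEdgesIn (R : ℕ) : Finset (Sym2 (Site 3)) :=
  ((box 3 R).sym2).filter fun e => e ∈ floorEdges

/-- `g_j(s) := Σ_{e floor edge in Λ_{r+j+1}} P_s(e is pivotal for armFrom r j)`; by Russo,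
`s · g_j(s) = E_s[# open pivotal floor edges]` and `f_j'(s) ≥ g_j(s)`. -/
def pivotalFloorSum (r j : ℕ) (s : unitInterval) : ℝ :=
  ∑ e ∈ floorEdgesIn (r + j + 1), (μfloor s).real {ω | IsPivotal (armFrom r j) e ω}

/-- `I_j := ∫₀^{p_c} g_j(s)/f_j(s) ds` — the `s`-integrated conditional count of pivotal floor edges
(`= ∫₀^{p_c} E_s[# open pivotal floor edges | arm_j] ds/s`). -/
def floorLogGain (r j : ℕ) : ℝ :=
  ∫ s in (0 : ℝ)..(criticalProbI 3 : ℝ),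
    pivotalFloorSum r j (Set.projIcc (0 : ℝ) 1 zero_le_one s) /
      armProbFloor r j (Set.projIcc (0 : ℝ) 1 zero_le_one s)

/-- **(G)**, the uniform microscopic floor-doubling gain (card), weakened as the triage allows
(start at any fixed depth `h₀`): doubling the depth of the floor below the start multiplies the arm
probability by at least `1 + κ`, uniformly for depths `h₀ ≤ h ≤ r^δ/2`. -/
def FloorGain : Prop :=
  ∃ κ δ : ℝ, ∃ h₀ : ℕ, 0 < κ ∧ 0 < δ ∧ 1 ≤ h₀ ∧ ∀ r h : ℕ, h₀ ≤ h →
    ((2 * h : ℕ) : ℝ) ≤ (r : ℝ) ^ δ → (1 + κ) * gammaR r h ≤ gammaR r (2 * h)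

/-! ## The four stub statements -/

/-- STUB 1 statement: free monotonicity in the depth. -/
def DepthMono : Prop := ∀ r h : ℕ, gammaR r h ≤ gammaR r (h + 1)

/-- STUB 2 statement: the `s = 0` end of the interpolation dominates the previous depth. -/
def NoFloor : Prop := ∀ r j : ℕ, gammaR r j ≤ armProbFloor r (j + 1) 0

/-- STUB 3 statement: integrated one-sided Russo formula in the floor parameter. -/
def FloorRusso : Prop :=
  ∀ r j : ℕ, armProbFloor r j 0 * Real.exp (floorLogGain r j) ≤ gammaR r j

/-- STUB 4 statement (load-bearing): dyadic lower bound on the integrated pivotal-floor density. -/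
def PivotalFloorDensity : Prop :=
  ∃ κ' δ : ℝ, ∃ h₀ : ℕ, 0 < κ' ∧ 0 < δ ∧ 1 ≤ h₀ ∧ ∀ r h : ℕ, h₀ ≤ h →
    ((2 * h : ℕ) : ℝ) ≤ (r : ℝ) ^ δ → κ' ≤ ∑ j ∈ Finset.Ioc h (2 * h), floorLogGain r j

/-! ## Registered stubs -/

/-- **STUB 1 `depthMono`** (S/M, PROVABLE NOW): `γ_r(h) ≤ γ_r(h+1)`. The vertical shift `x ↦ x + e₀`
preserves `P_{p_c}` (`BondPercolationSymmetry`: `bondPercolation_real_preimage_relabel_iso` with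
`zdShiftIso`) and maps `armFrom r h` into "arm from height `h+1` inside `{x₀ ≥ 1}`" `⊆ armFrom r (h+1)`
(`openConnIn` is monotone in the domain; distances are measured from the start, so the same witness
`y + e₀` works). [card First lemma; triage r1-1/2/3 checked] -/
theorem stub_depthMono : DepthMono := by
  sorry

/-- **STUB 2 `noFloor`** (M, PROVABLE NOW): `γ_r(j) ≤ f_{j+1}(0)`. Under `μfloor 0` the floor edges are
a.s. closed and the other lattice edges are i.i.d. at `p_c`: `μfloor 0` is the law of `ω ∖ floorEdges`
under `P_{p_c}` (`prodBernoulli` API: `prodBernoulli_indicator_holds`, `prodBernoulli_map_inter`-type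
marginal lemmas). The event "arm from height `j+1` inside `{x₀ ≥ 1}`" does not look at floor edges, is
contained in `armFrom r (j+1)`, and has `P_{p_c}`-probability `γ_r(j)` by the vertical shift (as in
STUB 1). -/
theorem stub_noFloor : NoFloor := by
  sorry

/-- **STUB 3 `floorRusso`** (M, PROVABLE NOW): `f_j(0) · exp(I_j) ≤ γ_r(j)`.
(i) `μfloor (p_c) = P_{p_c}` (`floorParams (criticalProbI 3) = 𝟙_{E(ℤ³)} · p_c`, `prodBernoulli_indicator_holds`),
so `f_j(p_c) = γ_r(j)`. (ii) `armFrom r j` is increasing and determined by the finite set `K` of lattice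
edges inside the sup-ball of radius `r` about `j·e₀` (first exit), so along the path
`s ↦ floorParams s` (derivative `1` on floor edges, `0` elsewhere) the tree's multi-parameter Russo
formula `hasDerivAt_prodBernoulli_real` gives `f_j'(s) = Σ_{e ∈ K ∩ floor} P_s(e pivotal) ≥ g_j(s)`
(edges outside `K` are never pivotal, `EnhProp42.isPivotal_iff_of_determinedBy`; all terms `≥ 0`, so
under-coverage by `floorEdgesIn (r+j+1) ⊇ K ∩ floor` is harmless). (iii) `f_j, g_j` are polynomials in
`s` (`RussoPath.prodBernoulli_real_eq_sum_powerset`); if `f_j(0) = 0` the claim is trivial, else `f_j > 0`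
on `[0, p_c]` and `log f_j(p_c) - log f_j(0) = ∫ f_j'/f_j ≥ ∫ g_j/f_j = I_j` (FTC,
`intervalIntegral.integral_eq_sub_of_hasDerivAt` + `integral_mono`). -/
theorem stub_floorRusso : FloorRusso := by
  sorry

/-- **STUB 4 `pivotalFloorDensity`** (L/XL, OPEN — THE LOAD-BEARING STUB; the lead's):
`∃ κ' δ h₀, ∀ r, ∀ h ∈ [h₀, r^δ/2] : Σ_{j ∈ (h,2h]} I_j ≥ κ'`. Heuristic value: `I_j ≈ log(γ_r(j)/γ_r(j-1))
≈ (x_s - x_b)/j ≈ 0.50/j` in the crossover window `1 ≪ j ≪ r` (surface vs bulk one-arm exponents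
`x_s ≈ 0.975`, `x_b ≈ 0.477`; gain `2^{1/3-5/48}` per doubling in `d = 2`, `2` in `d > 6`), so `κ' ≈ 0.35`;
triage-2 MC: `γ_r(2h)/γ_r(h) = 1.22–1.29` at `r = 16, 32`, rising with `r`. WHERE THE MASS SITS: at `s = 0`
(floor a.s. closed) a floor edge `{u,v}` is pivotal iff the floor-less cluster of the start hangs a pendant
at `u`, misses `v` and does not reach `r`, while the floor-less cluster of `v` does — a "second-bush" event of
the card's §(4) type (two disjoint bushes glued by ONE floor edge), whose yield the card estimates as
`(c/j)·ρ(j)` with a boundary two-arm repulsion factor `ρ(j) → 0`, i.e. summable in `j`. So, heuristically,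
the bound cannot come from small `s`; it must come from `s` comparable to `p_c`, where the open floor
clusters (2D bond percolation at `s ≤ p_c(ℤ³) ≈ 0.2488 < 1/2 = p_c(ℤ²)`: strictly subcritical,
`FloorSubcritical` stmt-1337 + `perc_sharpness_holds`, exponential tails) act as `O(1)`-size bridges and a
SINGLE arm dips through them ("single-arm dipping"). Why it might fail: it is a uniform low-probability-regime sensitivity
statement (quasi-multiplicativity class), proved in `d = 2` only through RSW; no 3D member of the class is
known (card + all three triagers). False above `p_c` (it implies the crux), so its proof must use
`s, p ≤ p_c`: this is where `quantitativeBGNAt_false_of_criticalProb_lt` is honoured. -/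
theorem stub_pivotalFloorDensity : PivotalFloorDensity := by
  sorry

/-! ### Name-keyed aliases of the stub statements (hypotheses of the composition) -/
namespace Registered

/-- Alias of `DepthMono` keyed by the registered stub name. -/
abbrev stub_depthMono : Prop := DepthMono
/-- Alias of `NoFloor` keyed by the registered stub name. -/
abbrev stub_noFloor : Prop := NoFloor
/-- Alias of `FloorRusso` keyed by the registered stub name. -/
abbrev stub_floorRusso : Prop := FloorRusso
/-- Alias of `PivotalFloorDensity` keyed by the registered stub name. -/
abbrev stub_pivotalFloorDensity : Prop := PivotalFloorDensity

end Registered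

/-! ## Proved plumbing -/

/-- At depth `0` the event is the crux event read on the lattice part of `ω`. -/
theorem armFrom_zero (r : ℕ) :
    armFrom r 0 = {ω | ∃ y : Site 3, (∃ i : Fin 3, (r : ℤ) ≤ |y i|) ∧
      ω ∩ (zdGraph 3).edgeSet ∈ openConnIn {x : Site 3 | 0 ≤ x 0} 0 y} := by
  ext ω
  simp [armFrom]

/-- `γ_r(0)` IS the probability bounded in `QuantitativeBGN` (configurations are a.s. supported on
the lattice edges: `DCT16.real_congr_of_forall_subset_edgeSet`). -/
theorem gammaR_zero_eq (r : ℕ) :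
    gammaR r 0 = (bondPercolation (zdGraph 3) (criticalProbI 3)).real
      {ω | ∃ y : Site 3, (∃ i : Fin 3, (r : ℤ) ≤ |y i|) ∧
        ω ∈ openConnIn {x : Site 3 | 0 ≤ x 0} 0 y} := by
  rw [gammaR, armFrom_zero]
  refine DCT16.real_congr_of_forall_subset_edgeSet (zdGraph 3) (criticalProbI 3) fun ω hω => ?_
  simp only [Set.mem_setOf_eq, Set.inter_eq_left.2 hω]

theorem gammaR_nonneg (r h : ℕ) : 0 ≤ gammaR r h := measureReal_nonneg

theorem gammaR_le_one (r h : ℕ) : gammaR r h ≤ 1 := measureReal_le_one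

/-- `γ_r(0)` is the disprover's `armH` probability (readback against the landed Negative lane). -/
theorem gammaR_zero_eq_armH (r : ℕ) :
    gammaR r 0 = μc.real (Theorems.QuantitativeBGN.Negative.armH r) := by
  rw [gammaR_zero_eq]; rfl

/-- NO JUNK (Disproof honoured): under STUB 1 every `γ_r(h)`, `r ≥ 1`, is bounded below by the landed
`armH_lower_bound` `≥ 1/(588 r²) > 0`, so all ratios `γ_r(2h)/γ_r(h)` of the line compare positive numbers. -/
theorem gammaR_pos (hmono : DepthMono) {r : ℕ} (hr : 1 ≤ r) (h : ℕ) : 0 < gammaR r h := by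
  have hmon : Monotone (gammaR r) := monotone_nat_of_le_succ fun k => hmono r k
  refine lt_of_lt_of_le ?_ (hmon (Nat.zero_le h))
  obtain ⟨n, rfl⟩ : ∃ n, r = n + 1 := ⟨r - 1, by omega⟩
  have hlow := Theorems.QuantitativeBGN.Negative.armH_lower_bound n
  rw [gammaR_zero_eq_armH]
  exact lt_of_lt_of_le (by positivity) hlow

/-! ## Composition, part 1: STUBS 2–4 ⟹ (G) -/

/-- Telescoping: `γ_r(j) e^{I_{j+1}} ≤ f_{j+1}(0) e^{I_{j+1}} ≤ γ_r(j+1)`, multiplied over a dyadic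
block, and STUB 4 bounds the exponent sum below. -/
theorem floorGain_of_russo (hnf : NoFloor) (hru : FloorRusso) (hpd : PivotalFloorDensity) :
    FloorGain := by
  obtain ⟨κ', δ, h₀, hκ', hδ, hh₀, hden⟩ := hpd
  refine ⟨Real.exp κ' - 1, δ, h₀, ?_, hδ, hh₀, fun r h hh hwin => ?_⟩
  · have := Real.add_one_lt_exp (ne_of_gt hκ')
    linarith
  have step : ∀ j : ℕ, gammaR r j * Real.exp (floorLogGain r (j + 1)) ≤ gammaR r (j + 1) :=
    fun j => le_trans (mul_le_mul_of_nonneg_right (hnf r j) (Real.exp_nonneg _)) (hru r (j + 1))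
  have tele : ∀ n : ℕ, gammaR r h * Real.exp (∑ j ∈ Finset.Ioc h (h + n), floorLogGain r j) ≤
      gammaR r (h + n) := by
    intro n
    induction n with
    | zero => simp
    | succ n ih =>
      rw [← add_assoc, Finset.sum_Ioc_succ_top (by omega : h ≤ h + n), Real.exp_add, ← mul_assoc]
      exact le_trans (mul_le_mul_of_nonneg_right ih (Real.exp_nonneg _)) (step (h + n))
  have key := tele h
  rw [← two_mul] at key
  have hsum : κ' ≤ ∑ j ∈ Finset.Ioc h (2 * h), floorLogGain r j := hden r h hh hwin
  calc (1 + (Real.exp κ' - 1)) * gammaR r h = gammaR r h * Real.exp κ' := by ring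
    _ ≤ gammaR r h * Real.exp (∑ j ∈ Finset.Ioc h (2 * h), floorLogGain r j) :=
        mul_le_mul_of_nonneg_left (Real.exp_le_exp.2 hsum) (gammaR_nonneg r h)
    _ ≤ gammaR r (2 * h) := key

/-! ## Composition, part 2: STUB 1 + (G) ⟹ the crux (the iteration) -/

/-- Iterated gain along the depths `h₀ · 2^j` inside the window. -/
theorem iter_gain {κ δ : ℝ} {h₀ : ℕ} (hκ : 0 < κ)
    (hG : ∀ r h : ℕ, h₀ ≤ h → ((2 * h : ℕ) : ℝ) ≤ (r : ℝ) ^ δ →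
      (1 + κ) * gammaR r h ≤ gammaR r (2 * h))
    (r : ℕ) : ∀ j : ℕ, ((h₀ * 2 ^ j : ℕ) : ℝ) ≤ (r : ℝ) ^ δ →
      (1 + κ) ^ j * gammaR r h₀ ≤ gammaR r (h₀ * 2 ^ j) := by
  intro j
  induction j with
  | zero => intro _; simp
  | succ j ih =>
    intro hj
    have hmono_pow : h₀ * 2 ^ j ≤ h₀ * 2 ^ (j + 1) :=
      Nat.mul_le_mul_left h₀ (Nat.pow_le_pow_right (by norm_num) (Nat.le_succ j))
    have hle : ((h₀ * 2 ^ j : ℕ) : ℝ) ≤ (r : ℝ) ^ δ := le_trans (by exact_mod_cast hmono_pow) hj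
    have h1 := ih hle
    have h3 : 2 * (h₀ * 2 ^ j) = h₀ * 2 ^ (j + 1) := by ring
    have h2 : (1 + κ) * gammaR r (h₀ * 2 ^ j) ≤ gammaR r (h₀ * 2 ^ (j + 1)) := by
      rw [← h3]
      refine hG r (h₀ * 2 ^ j) (Nat.le_mul_of_pos_right _ (by positivity)) ?_
      rw [h3]; exact hj
    calc (1 + κ) ^ (j + 1) * gammaR r h₀ = (1 + κ) * ((1 + κ) ^ j * gammaR r h₀) := by ring
      _ ≤ (1 + κ) * gammaR r (h₀ * 2 ^ j) := mul_le_mul_of_nonneg_left h1 (by linarith)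
      _ ≤ gammaR r (h₀ * 2 ^ (j + 1)) := h2

/-- **(G) ⟹ QuantitativeBGN** with `a = δ · log₂(1+κ)` and `C = (1+κ) · h₀^{log₂(1+κ)}`:
`γ_r(0) ≤ γ_r(h₀) ≤ (1+κ)^{-J}` with `J = ⌊log₂(r^δ/h₀)⌋`, and `(1+κ)^{log₂ y} = y^{log₂(1+κ)}`.
The conclusion is written as the disprover's readback `QuantitativeBGNAt (criticalProbI 3)` (= the crux by
`quantitativeBGN_iff`, `Iff.rfl`, landed in `Negative/ArmLowerBound.lean`) so that `QuantitativeBGN_of` below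
is the ONLY theorem of the file whose conclusion is the crux decl by name (unambiguous skeleton audit). -/
theorem quantitativeBGN_of_floorGain (hmono : DepthMono) (hG : FloorGain) :
    Theorems.QuantitativeBGN.Negative.QuantitativeBGNAt (criticalProbI 3) := by
  obtain ⟨κ, δ, h₀, hκ, hδ, hh₀, hG⟩ := hG
  set L : ℝ := Real.logb 2 (1 + κ) with hL
  have hκ1 : (1 : ℝ) < 1 + κ := by linarith
  have hLpos : 0 < L := Real.logb_pos (by norm_num) hκ1
  set a : ℝ := δ * L with ha
  have hapos : 0 < a := mul_pos hδ hLpos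
  set C : ℝ := (1 + κ) * (h₀ : ℝ) ^ L with hC
  refine ⟨a, C, hapos, fun r hr => ?_⟩
  have hmon : Monotone (gammaR r) := monotone_nat_of_le_succ fun k => hmono r k
  have hr0 : (0 : ℝ) < r := by exact_mod_cast hr
  have hh0 : (0 : ℝ) < h₀ := by exact_mod_cast hh₀
  have hra : (r : ℝ) ^ a = ((r : ℝ) ^ δ) ^ L := by rw [ha, Real.rpow_mul hr0.le]
  have key : gammaR r 0 ≤ C * (r : ℝ) ^ (-a) := by
    by_cases hwin : (h₀ : ℝ) ≤ (r : ℝ) ^ δ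
    · -- the window [h₀, r^δ] contains J = ⌊log₂(r^δ/h₀)⌋ doublings
      set x : ℝ := Real.logb 2 ((r : ℝ) ^ δ / h₀) with hx
      have hx0 : 0 ≤ x := Real.logb_nonneg (by norm_num) (by rwa [le_div_iff₀ hh0, one_mul])
      set J : ℕ := ⌊x⌋₊ with hJ
      have hJle : (J : ℝ) ≤ x := Nat.floor_le hx0
      have hJgt : x < J + 1 := Nat.lt_floor_add_one x
      have h2x : (2 : ℝ) ^ x = (r : ℝ) ^ δ / h₀ :=
        Real.rpow_logb (by norm_num) (by norm_num) (by positivity)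
      have hpow : ((h₀ * 2 ^ J : ℕ) : ℝ) ≤ (r : ℝ) ^ δ := by
        push_cast
        have h2J : (2 : ℝ) ^ (J : ℝ) ≤ 2 ^ x := Real.rpow_le_rpow_of_exponent_le (by norm_num) hJle
        rw [Real.rpow_natCast] at h2J
        calc (h₀ : ℝ) * 2 ^ J ≤ h₀ * 2 ^ x := mul_le_mul_of_nonneg_left h2J hh0.le
          _ = h₀ * ((r : ℝ) ^ δ / h₀) := by rw [h2x]
          _ = (r : ℝ) ^ δ := by field_simp
      have hchain := iter_gain hκ hG r J hpow
      have hle1 : gammaR r (h₀ * 2 ^ J) ≤ 1 := gammaR_le_one _ _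
      have hpowpos : (0 : ℝ) < (1 + κ) ^ J := by positivity
      have hγh₀ : gammaR r h₀ ≤ 1 / (1 + κ) ^ J := by
        rw [le_div_iff₀ hpowpos, mul_comm]
        exact hchain.trans hle1
      -- (1+κ)^J ≥ (1+κ)^(x-1) = (1+κ)^x/(1+κ) and (1+κ)^x = r^a / h₀^L
      have h1 : (1 + κ) ^ (x - 1) ≤ (1 + κ) ^ J := by
        have := Real.rpow_le_rpow_of_exponent_le hκ1.le (by linarith : x - 1 ≤ (J : ℝ))
        rwa [Real.rpow_natCast] at this
      have h2 : (1 + κ) ^ (x - 1) = (1 + κ) ^ x / (1 + κ) :=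
        Real.rpow_sub_one (by positivity) x
      have h3 : (1 + κ) ^ x = (r : ℝ) ^ a / (h₀ : ℝ) ^ L := by
        rw [Real.rpow_def_of_pos (by linarith), Real.rpow_def_of_pos hr0, Real.rpow_def_of_pos hh0,
          ← Real.exp_sub]
        congr 1
        have hlog2 : Real.log 2 ≠ 0 := by positivity
        rw [hx, ha, hL, Real.logb, Real.logb, Real.log_div (by positivity) (by positivity),
          Real.log_rpow hr0]
        field_simp
      have hxpos : (0 : ℝ) < (1 + κ) ^ (x - 1) := by positivity
      have hrapos : (0 : ℝ) < (r : ℝ) ^ a := by positivity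
      have hh0L : (0 : ℝ) < (h₀ : ℝ) ^ L := by positivity
      calc gammaR r 0 ≤ gammaR r h₀ := hmon (Nat.zero_le _)
        _ ≤ 1 / (1 + κ) ^ J := hγh₀
        _ ≤ 1 / (1 + κ) ^ (x - 1) := by gcongr
        _ = (1 + κ) * (h₀ : ℝ) ^ L / (r : ℝ) ^ a := by
            rw [h2, h3]; field_simp
        _ = C * (r : ℝ) ^ (-a) := by
            rw [hC, Real.rpow_neg hr0.le, div_eq_mul_inv]
    · -- empty window: the bound is ≥ 1
      have hlt : (r : ℝ) ^ δ < h₀ := lt_of_not_ge hwin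
      have hlt' : ((r : ℝ) ^ δ) ^ L < (h₀ : ℝ) ^ L := Real.rpow_lt_rpow (by positivity) hlt hLpos
      have hrapos : (0 : ℝ) < (r : ℝ) ^ a := by positivity
      have hone : (1 : ℝ) ≤ C * (r : ℝ) ^ (-a) := by
        rw [hC, Real.rpow_neg hr0.le, hra]
        rw [hra] at hrapos
        have : (1 : ℝ) ≤ (h₀ : ℝ) ^ L * (((r : ℝ) ^ δ) ^ L)⁻¹ := by
          rw [← div_eq_mul_inv, one_le_div hrapos]; exact hlt'.le
        nlinarith [this, hκ, inv_pos.2 hrapos, hlt'.le]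
      exact (gammaR_le_one r 0).trans hone
  rw [gammaR_zero_eq_armH] at key
  exact key

/-! ## The composition, by name -/

/-- **`QuantitativeBGN_of`**: the four registered stubs imply the crux
`Summit.CriticalPhenomena.PercolationContinuityZ3.Theses.PercLowPointHalfSpace.QuantitativeBGN`
(kernel-checked; no `sorry` outside the stubs). -/
theorem QuantitativeBGN_of (h1 : Registered.stub_depthMono) (h2 : Registered.stub_noFloor)
    (h3 : Registered.stub_floorRusso) (h4 : Registered.stub_pivotalFloorDensity) :
    Summit.CriticalPhenomena.PercolationContinuityZ3.Theses.PercLowPointHalfSpace.QuantitativeBGN :=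
  Theorems.QuantitativeBGN.Negative.quantitativeBGN_iff.2
    (quantitativeBGN_of_floorGain h1 (floorGain_of_russo h2 h3 h4))

/-- Wiring check: the registered stubs feed `QuantitativeBGN_of` as stated. -/
example : Summit.CriticalPhenomena.PercolationContinuityZ3.Theses.PercLowPointHalfSpace.QuantitativeBGN :=
  QuantitativeBGN_of stub_depthMono stub_noFloor stub_floorRusso stub_pivotalFloorDensity

/-! ## Readback against the landed Negative lane (examples, so `QuantitativeBGN_of` stays the only
named theorem concluding the crux) -/

/-- Exponent window honoured: the crux with any exponent `a > 2` is refuted (landed); the line's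
output `a = δ log₂(1+κ)` is unconstrained below and is consistent. -/
example {a : ℝ} (ha : 2 < a) : ¬ Theorems.QuantitativeBGN.Negative.QuantitativeBGNWith a :=
  Theorems.QuantitativeBGN.Negative.not_quantitativeBGNWith_of_two_lt ha

/- Criticality is load-bearing (landed, `Negative/LoadBearing.lean`:
`quantitativeBGNAt_false_of_criticalProb_lt` — the crux's bound fails at every `p > p_c`); STUB 4 is the
one statement of the line that is false there. (Not imported: that module was not yet built on the farm
when this skeleton was checked; `Negative/ArmLowerBound.lean` is.) -/

end Summit.CriticalPhenomena.PercolationContinuityZ3.Cruxes.QuantitativeBGN.MicroscopicFloorDoublingGain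

end
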